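import Literature.MathematicalPhysics.QuantumLattice.SpinGroundStatesMinimiseMeanEnergy
import Literature.MathematicalPhysics.QuantumLattice.SpinSparseKrausPerturbedState
import HarnessLib

/-!
# Translation-invariant minimisers of the mean energy of a quantum SPIN system are ground states
# (Bratteli–Kishimoto–Robinson 1978, Theorem 2, direction `2 ⇒ 1`; Ruelle 1969), and the discharge of
# the named fact `BratteliKishimotoRobinson1978_theorem2`

Topic `Literature/MathematicalPhysics/QuantumLattice`; namespace
`Literature.MathematicalPhysics.QuantumLattice` (the file path). Vocabulary of `InfiniteVolumeStates.lean`
(`Op ↥Λ q`, `embedOp`, `InfVolState`, `thicken`, `derivation`, `InfVolState.IsGroundState`),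
`TranslationInvariantGroundStates.lean` (`meanEnergyObs`, `InfVolState.meanEnergy`,
`InfVolState.IsMeanEnergyMinimiser`, the named fact `BratteliKishimotoRobinson1978_theorem2`),
`SpinSparseKrausPerturbedState.lean` (`krausMapOp`, `SpinKrausPattern`, `placed`, `sparseState`,
`cellState`) and `SpinGroundStatesMinimiseMeanEnergy.lean` (the direction `1 ⇒ 2`,
`InfVolState.IsGroundState.isMeanEnergyMinimiser`). Everything here is PROVED; no named fact is
introduced. This is the spin-system twin of the tree's fermionic `SparseKrausPerturbedStateEnergy.lean`
and `MeanEnergyMinimisersAreGroundStates.lean` (lattice FERMIONS, `InfVolFermionState`, by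
`hubbard-pc-lit-1`), with plain locality replacing graded locality (no evenness hypotheses, no parity
splitting, and therefore no restriction on the dimension `d`).

## Main results

* §2 `SpinKrausPattern.meanEnergy_cellState_eq` — **the energy bookkeeping**: for a translation-invariant
  interaction `Φ` of finite range `R`, a translation-invariant state `ω`, and a spin Kraus pattern
  `P = (Λ₀, V, a)` with spacing `a > (extent of Λ₀) + ⌊R⌋`, the translation-invariant cell average `ω̄`
  of the sparse perturbations of `ω` has mean energy
  `e_Φ(ω̄) = e_Φ(ω) + a^{-d} · Re[ ω(𝓔(H_U)) − ω(H_U) ]`, `U = (Λ₀)_{R,R}`, `𝓔 = Σ_k V_k⋆(·)V_k` placed at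
  `Λ₀`.
* §4 `InfVolState.IsMeanEnergyMinimiser.re_expect_le_re_expect_krausMapOp` — **complete-positivity
  stability of a minimiser**: `Re ω(H_{Λ_R}) ≤ Re ω(𝓔(H_{Λ_R}))` for every region `Λ` and every finite
  Kraus family `V_k ∈ 𝔄_Λ`, `Σ V_k⋆V_k = 𝟙`.
* §5 `InfVolState.IsMeanEnergyMinimiser.isGroundState` — **Theorem 2, `2 ⇒ 1`**: a translation-invariant
  minimiser of the mean energy of a Hermitian, translation-invariant, finite-range interaction is a ground
  state (`-i ω(A⋆δ(A)) ≥ 0` for every local `A`), ANY `d` and `q`; with §3's second-order expansion of the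
  Kraus pair `(tA, √(1 − t²A⋆A))` (continuous functional calculus) and stationarity.
* §5 `InfVolState.isMeanEnergyMinimiser_iff_isGroundState` (both directions) and the DISCHARGE
  `BratteliKishimotoRobinson1978_theorem2_holds : BratteliKishimotoRobinson1978_theorem2`.

## Source, and what is printed (held text `paper:doi-10-1007-bf01940760`, pp. 47–48 read)

O. Bratteli, A. Kishimoto, D. W. Robinson, *Ground states of quantum spin systems*, Commun. Math. Phys.
**64** (1978) 41–48 [BratteliKishimotoRobinson1978], Theorem 2 (p. 47): for a `ℤ^ν`-invariant interaction
with `‖Φ‖_λ < ∞` and a `ℤ^ν`-invariant state `ω`, "1. `ω` is a `τ^Φ`-ground state" ⟺ "2. `ω` minimizes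
`H_Φ`"; p. 48: "`2 ⇒ 1`. This has already been proved by Ruelle [9]" (D. Ruelle, Commun. Math. Phys. 11
(1969) 339–345, Thm. 2 and Thm. 4 [Ruelle1969GroundState], through unique tangent functionals of the
pressure and the density of differentiable interactions). HERE, as in the tree's fermionic twin, the
finite-range structure is used directly instead: perturb `ω` by the completely positive unital map
`𝓔 = Σ_k V_k⋆(·)V_k` simultaneously at all translates `x + Λ`, `x ≡ r (mod a)`, average over
`r ∈ (ℤ/aℤ)^d` (`SpinSparseKrausPerturbedState.lean`); the result is translation invariant with
`e_Φ(ω̄) = e_Φ(ω) + a^{-d} Re[ω(𝓔(H)) − ω(H)]` (§2: only finitely many translates meet a region of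
diameter `≤ R`, at most one of each sparse class does, the classes partition all translates, and
translation invariance of `ω` and `Φ` reduces every contribution to the one at `Λ₀` — a double counting
over rooted regions `(Z, y)`); minimality gives `Re ω(𝓔(H)) ≥ Re ω(H)`; applied to the Kraus PAIR
`V₁ = tA`, `V₂ = √(1 − t²A⋆A)` and expanded to second order in `t` (§3: `‖1 − V₂‖ ≤ t²‖A⋆A‖`,
`‖1 − V₂ − ½t²A⋆A‖ ≤ ½t⁴‖A⋆A‖²`) this yields the Bratteli–Robinson inequality `Re ω(A⋆[H, A]) ≥ 0`
as `t → 0`; local stability implies stationarity (`SpinGroundStatesMinimiseMeanEnergy.lean`), which makes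
`ω(A⋆[H,A])` real, and `-i ω(A⋆δ(A)) = ω((A⊗𝟙)⋆[H, A⊗𝟙]) ≥ 0`. Finite range instead of `‖Φ‖_λ < ∞`
(weaker than print, never stronger). Restated: Bratteli–Robinson II Thm. 6.2.58 [BratteliRobinsonII1997].

HONEST SCOPE: model-free statements about the tree's spin-system framework; nothing is claimed about the
existence or structure of ground states of any particular model.
-/

noncomputable section

namespace Literature.MathematicalPhysics.QuantumLattice

open Matrix Finset Literature.Probability.LatticeModels _root_.Filter
open scoped ComplexOrder _root_.Topology

variable {d q : ℕ}

/-! ### §1. Finite range, concretely (spin-system forms) -/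

namespace LatticeInteraction

variable {Φ : LatticeInteraction d q} {R : ℝ}

/-- Coordinates of two points of a region carrying a nonzero term differ by at most `⌊R⌋`.
[cite: BratteliRobinsonII1997, §6.2.1 (finite range)] -/
theorem HasFiniteRange.sub_le_floor (hR : Φ.HasFiniteRange R) {X : Finset (Site d)} (hX : Φ X ≠ 0)
    {p p' : Site d} (hp : p ∈ X) (hp' : p' ∈ X) (i : Fin d) : p i - p' i ≤ ⌊R⌋₊ := by
  obtain ⟨w, hw, rfl⟩ := mem_image.1 (hR.subset_image_box hX hp' hp)
  rw [mem_box] at hw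
  rw [Pi.add_apply, add_sub_cancel_left]
  exact (hw i).2

/-- A translate `Z - y` of a region carrying a nonzero term by one of its points lies in the
`R`-neighbourhood of the origin. [cite: BratteliRobinsonII1997, §6.2.1 (finite range)] -/
theorem HasFiniteRange.shiftSet_neg_subset_thicken_zero (hR : Φ.HasFiniteRange R) {Z : Finset (Site d)}
    (hZ : Φ Z ≠ 0) {y : Site d} (hy : y ∈ Z) : shiftSet (-y) Z ⊆ thicken ({0} : Finset (Site d)) R := by
  have h := shiftSet_subset_thicken_singleton (-y) (hR.subset_thicken_singleton hZ hy)
  rwa [add_neg_cancel] at h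

end LatticeInteraction

/-! ### §2. The mean energy of the cell-averaged sparse Kraus perturbation -/

namespace SpinKrausPattern

variable (P : SpinKrausPattern d q)

/-! #### The contribution of one translate -/

/-- **The energy of the term `Φ X` after the Kraus perturbation at the translate `x + Λ₀`**, computed in
the region `X ∪ (x + Λ₀)`: `ω(𝓔_x(Φ X))`. [cite: BratteliKishimotoRobinson1978, Thm. 2 (proof)] -/
def krausTerm (Φ : LatticeInteraction d q) (ω : InfVolState d q) (x : Site d) (X : Finset (Site d)) : ℂ :=
  ω.expect (X ∪ shiftSet x P.Λ₀)
    (krausMapOp (P.placed x Finset.subset_union_right) (embedOp Finset.subset_union_left (Φ X)))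

/-- The **energy change** `δ_x(X) = ω(𝓔_x(Φ X)) − ω(Φ X)` of the term `Φ X` under the perturbation at
`x + Λ₀`. [cite: BratteliKishimotoRobinson1978, Thm. 2 (proof)] -/
def delta (Φ : LatticeInteraction d q) (ω : InfVolState d q) (x : Site d) (X : Finset (Site d)) : ℂ :=
  P.krausTerm Φ ω x X - ω.expect X (Φ X)

/-- The energy change vanishes on regions carrying no term. [cite: BratteliKishimotoRobinson1978, Thm. 2 (proof)] -/
theorem delta_eq_zero_of_apply_eq_zero {Φ : LatticeInteraction d q} (ω : InfVolState d q) (x : Site d)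
    {X : Finset (Site d)} (hX : Φ X = 0) : P.delta Φ ω x X = 0 := by
  rw [delta, krausTerm, hX, embedOp_zero, map_zero, map_zero, map_zero, sub_zero]

/-- **The sparse perturbation changes the energy of `Φ X` by the contributions of the sparse translates
meeting `X`, when at most one does**: `ω_r(Φ X) − ω(Φ X) = Σ_{x ∈ touch_r X} δ_x(X)`.
[cite: BratteliKishimotoRobinson1978, Thm. 2 (proof)] -/
theorem sparseState_expect_sub_eq_sum_delta (Φ : LatticeInteraction d q) (ω : InfVolState d q)
    {r : Fin d → ZMod P.sk.a} {X : Finset (Site d)}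
    (hsub : ∀ x ∈ P.sk.touch r X, ∀ x' ∈ P.sk.touch r X, x = x') :
    (P.sparseState r ω).expect X (Φ X) - ω.expect X (Φ X) = ∑ x ∈ P.sk.touch r X, P.delta Φ ω x X := by
  classical
  rw [sparseState_expect]
  rcases (P.sk.touch r X).eq_empty_or_nonempty with h0 | ⟨x, hx⟩
  · -- no translate meets `X`: the sparse map is the identity
    have h1 : P.sparseMap r X (embedOp (P.sk.subset_hull r X) (Φ X)) = embedOp (P.sk.subset_hull r X) (Φ X) := by
      unfold sparseMap
      rw [Finset.noncommProd_congr h0 (fun _ _ => rfl), Finset.noncommProd_empty, Module.End.one_apply]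
    rw [h1, ω.compatible, sub_self, h0, Finset.sum_empty]
  · -- exactly one translate `x` meets `X`
    have h1 : P.sk.touch r X = {x} :=
      Finset.eq_singleton_iff_unique_mem.2 ⟨hx, fun x' hx' => hsub x' hx' x hx⟩
    have hxh : shiftSet x P.Λ₀ ⊆ P.sk.hull r X := P.sk.shiftSet_subset_hull hx
    have h2 : P.sparseMap r X (embedOp (P.sk.subset_hull r X) (Φ X)) =
        P.localMap (P.sk.hull r X) x (embedOp (P.sk.subset_hull r X) (Φ X)) := by
      unfold sparseMap
      rw [Finset.noncommProd_congr h1 (fun _ _ => rfl), Finset.noncommProd_singleton]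
    rw [h2, h1, Finset.sum_singleton, delta, krausTerm, P.localMap_of_subset hxh]
    congr 1
    -- move the Kraus term from `X ∪ (x + Λ₀)` into the hull
    have hsub' : X ∪ shiftSet x P.Λ₀ ⊆ P.sk.hull r X := Finset.union_subset (P.sk.subset_hull r X) hxh
    rw [← ω.compatible hsub', embedOp_krausMapOp, embedOp_embedOp]
    simp_rw [P.embedOp_placed hsub']

/-! #### Translation invariance reduces every contribution to the one at `Λ₀` -/

/-- **The energy change of `Φ Z` under the perturbation AT `Λ₀`** (computed in `Z ∪ Λ₀`):
`δ₀(Z) = ω(𝓔(Φ Z)) − ω(Φ Z)`. [cite: BratteliKishimotoRobinson1978, Thm. 2 (proof)] -/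
def delta0 (Φ : LatticeInteraction d q) (ω : InfVolState d q) (Z : Finset (Site d)) : ℂ :=
  ω.expect (Z ∪ P.Λ₀)
      (krausMapOp (fun k => embedOp Finset.subset_union_right (P.V k))
        (embedOp Finset.subset_union_left (Φ Z))) -
    ω.expect Z (Φ Z)

/-- `δ₀` vanishes on regions carrying no term. [cite: BratteliKishimotoRobinson1978, Thm. 2 (proof)] -/
theorem delta0_eq_zero_of_apply_eq_zero {Φ : LatticeInteraction d q} (ω : InfVolState d q)
    {Z : Finset (Site d)} (hZ : Φ Z = 0) : P.delta0 Φ ω Z = 0 := by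
  rw [delta0, hZ, embedOp_zero, map_zero, map_zero, map_zero, sub_zero]

/-- `δ₀` vanishes on regions disjoint from `Λ₀` (the Kraus map fixes `Φ Z ⊗ 𝟙` by locality).
[cite: BratteliRobinsonII1997, §6.2.1 (locality)] -/
theorem delta0_eq_zero_of_disjoint (Φ : LatticeInteraction d q) (ω : InfVolState d q)
    {Z : Finset (Site d)} (hZ : Disjoint Z P.Λ₀) : P.delta0 Φ ω Z = 0 := by
  have hV : ∑ k, (embedOp (Finset.subset_union_right : P.Λ₀ ⊆ Z ∪ P.Λ₀) (P.V k))ᴴ *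
      embedOp (Finset.subset_union_right : P.Λ₀ ⊆ Z ∪ P.Λ₀) (P.V k) = 1 := by
    simp_rw [← embedOp_conjTranspose, ← embedOp_mul]
    rw [← embedOp_sum, P.sum_conjTranspose_mul, embedOp_one]
  rw [delta0, krausMapOp_eq_self_of_commute hV fun k => commute_embedOp_of_disjoint _ _ hZ.symm _ _,
    ω.compatible, sub_self]

/-- **Translation invariance of `ω` and `Φ` moves every contribution to `Λ₀`**:
`δ_x(Z + x) = δ₀(Z)`. [cite: BratteliKishimotoRobinson1978, Thm. 2 (ℤ^ν-invariant Φ and ω)] -/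
theorem delta_shiftSet {Φ : LatticeInteraction d q} (hT : Φ.IsTranslationInvariant) {ω : InfVolState d q}
    (hωT : ω.IsTranslationInvariant) (x : Site d) (Z : Finset (Site d)) :
    P.delta Φ ω x (shiftSet x Z) = P.delta0 Φ ω Z := by
  unfold delta delta0 krausTerm
  congr 1
  · have hU : shiftSet x (Z ∪ P.Λ₀) ⊆ shiftSet x Z ∪ shiftSet x P.Λ₀ :=
      (Finset.map_union (f := (Site.shift x).toEmbedding) Z P.Λ₀).subset
    conv_rhs => rw [← hωT x, InfVolState.shift_expect_shiftSet, ← ω.compatible hU,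
      embedOp_transportOp_krausMapOp]
    simp_rw [transportOp_shiftSet_embedOp, embedOp_embedOp]
    rw [hT.apply_shiftSet x Z]
    rfl
  · rw [hT.apply_shiftSet x Z, ← InfVolState.shift_expect_shiftSet, hωT x]

/-- `δ_x(X) = δ₀(X − x)`. [cite: BratteliKishimotoRobinson1978, Thm. 2 (ℤ^ν-invariant Φ and ω)] -/
theorem delta_eq_delta0 {Φ : LatticeInteraction d q} (hT : Φ.IsTranslationInvariant) {ω : InfVolState d q}
    (hωT : ω.IsTranslationInvariant) (x : Site d) (X : Finset (Site d)) :
    P.delta Φ ω x X = P.delta0 Φ ω (shiftSet (-x) X) := by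
  have h := P.delta_shiftSet hT hωT x (shiftSet (-x) X)
  rwa [KrausPattern.shiftSet_shiftSet_neg] at h

/-! #### Double counting over rooted regions -/

/-- **Double counting**: the contributions `|X|⁻¹ f(X − x)` summed over the regions `X ∋ 0` inside the
`R`-ball and the translates `x` meeting them equal the contributions `|Z|⁻¹ f(Z)` summed over the
rooted regions `(Z, y)`, `y ∈ Z`, with `Z ⊆ U = (Λ₀)_{R,R}` meeting `Λ₀` and `Z − y` inside the `R`-ball
(`(X, x) ↦ (X − x, −x)`). [cite: Ruelle1969GroundState, §2 eq. (4) (the weights `N(X)⁻¹`)] -/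
theorem sum_sum_allTouch_eq_sum_rooted (f : Finset (Site d) → ℂ) (R : ℝ) :
    ∑ X ∈ (thicken ({0} : Finset (Site d)) R).powerset with (0 : Site d) ∈ X,
        ∑ x ∈ P.sk.allTouch X, ((X.card : ℂ)⁻¹) * f (shiftSet (-x) X) =
      ∑ Z ∈ (thicken (thicken P.Λ₀ R) R).powerset with ¬ Disjoint Z P.Λ₀,
        ∑ y ∈ Z with shiftSet (-y) Z ⊆ thicken ({0} : Finset (Site d)) R,
          ((Z.card : ℂ)⁻¹) * f Z := by
  classical
  rw [Finset.sum_sigma', Finset.sum_sigma']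
  refine Finset.sum_nbij' (fun p => ⟨shiftSet (-p.2) p.1, -p.2⟩) (fun q => ⟨shiftSet (-q.2) q.1, -q.2⟩)
    ?_ ?_ ?_ ?_ ?_
  · -- the map lands in the rooted regions
    rintro ⟨X, x⟩ hp
    rw [Finset.mem_sigma, Finset.mem_filter, Finset.mem_powerset] at hp
    obtain ⟨⟨hXR, h0⟩, hx⟩ := hp
    obtain ⟨p₀, hp₀, hp₀x⟩ := P.sk.mem_allTouch.1 hx
    rw [Finset.mem_sigma, Finset.mem_filter, Finset.mem_powerset, Finset.mem_filter]
    refine ⟨⟨P.sk.shiftSet_neg_subset_U hXR hx, ?_⟩, ?_, ?_⟩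
    · rw [Finset.not_disjoint_iff]
      exact ⟨p₀, by rw [mem_shiftSet, sub_neg_eq_add]; exact hp₀x, hp₀⟩
    · rw [mem_shiftSet, sub_neg_eq_add, neg_add_cancel]; exact h0
    · rw [neg_neg, KrausPattern.shiftSet_shiftSet_neg]; exact hXR
  · -- the inverse map lands in the pointed regions inside the ball
    rintro ⟨Z, y⟩ hq
    rw [Finset.mem_sigma, Finset.mem_filter, Finset.mem_powerset, Finset.mem_filter] at hq
    obtain ⟨⟨-, hZ⟩, hy, hyR⟩ := hq
    obtain ⟨p₀, hp₀Z, hp₀⟩ := Finset.not_disjoint_iff.1 hZ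
    rw [Finset.mem_sigma, Finset.mem_filter, Finset.mem_powerset]
    refine ⟨⟨hyR, ?_⟩, ?_⟩
    · rw [mem_shiftSet, sub_neg_eq_add, zero_add]; exact hy
    · rw [P.sk.mem_allTouch]
      exact ⟨p₀, hp₀, by rw [mem_shiftSet, sub_neg_eq_add, add_assoc, neg_add_cancel, add_zero]; exact hp₀Z⟩
  · rintro ⟨X, x⟩ _
    simp only [neg_neg, KrausPattern.shiftSet_shiftSet_neg]
  · rintro ⟨Z, y⟩ _
    simp only [neg_neg, KrausPattern.shiftSet_shiftSet_neg]
  · rintro ⟨X, x⟩ _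
    simp only [card_shiftSet]

/-- **For a rooted region every root is admissible or the contribution vanishes**:
`Σ_{y ∈ Z, Z−y ⊆ B_R} |Z|⁻¹ δ₀(Z) = δ₀(Z)` for `Z` meeting `Λ₀` (if `Φ Z ≠ 0` every `y ∈ Z` is admissible
by finite range; if `Φ Z = 0` both sides vanish). [cite: BratteliRobinsonII1997, §6.2.1 (finite range)] -/
theorem sum_roots_eq {Φ : LatticeInteraction d q} {R : ℝ} (hR : Φ.HasFiniteRange R) (ω : InfVolState d q)
    {Z : Finset (Site d)} (hZ : ¬ Disjoint Z P.Λ₀) :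
    ∑ y ∈ Z with shiftSet (-y) Z ⊆ thicken ({0} : Finset (Site d)) R, ((Z.card : ℂ)⁻¹) * P.delta0 Φ ω Z =
      P.delta0 Φ ω Z := by
  by_cases h0 : Φ Z = 0
  · rw [P.delta0_eq_zero_of_apply_eq_zero ω h0, mul_zero, Finset.sum_const_zero]
  · have hfilter : (Z.filter fun y => shiftSet (-y) Z ⊆ thicken ({0} : Finset (Site d)) R) = Z :=
      Finset.filter_true_of_mem fun y hy => hR.shiftSet_neg_subset_thicken_zero h0 hy
    rw [hfilter, Finset.sum_const, nsmul_eq_mul, ← mul_assoc]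
    have hne : Z.Nonempty := by
      obtain ⟨p₀, hp₀, -⟩ := Finset.not_disjoint_iff.1 hZ
      exact ⟨p₀, hp₀⟩
    have hc : (Z.card : ℂ) ≠ 0 := Nat.cast_ne_zero.2 (Finset.card_pos.2 hne).ne'
    rw [mul_inv_cancel₀ hc, one_mul]

/-- **The contributions at `Λ₀` sum to the energy change of the local Hamiltonian**:
`Σ_{Z ⊆ U} δ₀(Z) = ω(𝓔(H_U)) − ω(H_U)`. [cite: BratteliKishimotoRobinson1978, Thm. 2 (proof) and §3 (local Hamiltonians)] -/
theorem sum_delta0_powerset (Φ : LatticeInteraction d q) (ω : InfVolState d q) {U : Finset (Site d)}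
    (hU : P.Λ₀ ⊆ U) :
    ∑ Z ∈ U.powerset, P.delta0 Φ ω Z =
      ω.expect U (krausMapOp (fun k => embedOp hU (P.V k)) (localHamiltonian (Φ.restrict U) univ)) -
        ω.expect U (localHamiltonian (Φ.restrict U) univ) := by
  rw [localHamiltonian_restrict_eq_sum, map_sum, map_sum, map_sum, ← Finset.sum_sub_distrib]
  refine Finset.sum_congr rfl fun Z hZ => ?_
  rw [Finset.mem_powerset] at hZ
  rw [dif_pos hZ, delta0, ω.compatible hZ]
  congr 1
  have hZU : Z ∪ P.Λ₀ ⊆ U := Finset.union_subset hZ hU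
  rw [← ω.compatible hZU, embedOp_krausMapOp, embedOp_embedOp]
  simp_rw [embedOp_embedOp]

/-! #### The mean energy of the cell average -/

/-- **At most one translate of each sparse class meets a region of range `≤ ⌊R⌋`**, so the energy shift of
ONE sparse perturbation is, term by term, `ω_r(Φ X) − ω(Φ X) = Σ_{x ∈ touch_r X} δ_x(X)`.
[cite: BratteliKishimotoRobinson1978, Thm. 2 (proof)] -/
theorem sparseState_expect_sub_eq_sum_delta' {Φ : LatticeInteraction d q} {R : ℝ} (hR : Φ.HasFiniteRange R)
    (hsp : ∀ y ∈ P.Λ₀, ∀ y' ∈ P.Λ₀, ∀ i, y i - y' i + ⌊R⌋₊ < P.sk.a)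
    (ω : InfVolState d q) (r : Fin d → ZMod P.sk.a) (X : Finset (Site d)) :
    (P.sparseState r ω).expect X (Φ X) - ω.expect X (Φ X) = ∑ x ∈ P.sk.touch r X, P.delta Φ ω x X := by
  by_cases h0 : Φ X = 0
  · rw [h0, map_zero, map_zero, sub_zero]
    exact (Finset.sum_eq_zero fun x _ => P.delta_eq_zero_of_apply_eq_zero ω x h0).symm
  · exact P.sparseState_expect_sub_eq_sum_delta Φ ω
      (fun x hx x' hx' => P.sk.touch_subsingleton hsp (fun p hp p' hp' i => hR.sub_le_floor h0 hp hp' i) hx hx')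

/-- **The mean energy of the cell-averaged sparse Kraus perturbation.** For a translation-invariant
interaction `Φ` of finite range `R` of a quantum spin system, a translation-invariant state `ω`, and a spin
Kraus pattern `P = (Λ₀, V, a)` with spacing `a > (extent of Λ₀) + ⌊R⌋`:

  `e_Φ(cellState ω) = e_Φ(ω) + (a^d)⁻¹ · Re[ ω(𝓔(H_U)) − ω(H_U) ]`,  `U = thicken (thicken Λ₀ R) R`,

`𝓔 = Σ_k V_k⋆ (·) V_k` placed at `Λ₀ ⊆ U`, `H_U` the local Hamiltonian of `U`. (Perturbing at density
`a^{-d}` changes the mean energy by `a^{-d}` times the energy change of one local perturbation.) The energy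
bookkeeping behind Ruelle 1969 Thm. 2 / Bratteli–Kishimoto–Robinson 1978 Thm. 2 (`2 ⇒ 1`), done with the
finite-range structure instead of tangent functionals. [cite: BratteliKishimotoRobinson1978, Thm. 2; Ruelle1969GroundState Thm. 2] -/
theorem meanEnergy_cellState_eq [NeZero P.sk.a] {Φ : LatticeInteraction d q} {R : ℝ}
    (hR : Φ.HasFiniteRange R) (hT : Φ.IsTranslationInvariant)
    (hsp : ∀ y ∈ P.Λ₀, ∀ y' ∈ P.Λ₀, ∀ i, y i - y' i + ⌊R⌋₊ < P.sk.a)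
    (ω : InfVolState d q) (hωT : ω.IsTranslationInvariant) :
    (P.cellState ω).meanEnergy Φ R =
      ω.meanEnergy Φ R + ((P.sk.a : ℝ) ^ d)⁻¹ *
        (ω.expect (thicken (thicken P.Λ₀ R) R)
            (krausMapOp (fun k => embedOp ((subset_thicken P.Λ₀ R).trans (subset_thicken _ R)) (P.V k))
              (localHamiltonian (Φ.restrict (thicken (thicken P.Λ₀ R) R)) univ)) -
          ω.expect (thicken (thicken P.Λ₀ R) R)
            (localHamiltonian (Φ.restrict (thicken (thicken P.Λ₀ R) R)) univ)).re := by
  classical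
  set U := thicken (thicken P.Λ₀ R) R with hUdef
  have hΛU : P.Λ₀ ⊆ U := (subset_thicken P.Λ₀ R).trans (subset_thicken _ R)
  -- Step 1: the per-class energy shifts
  have hN : (Fintype.card (Fin d → ZMod P.sk.a) : ℝ) = (P.sk.a : ℝ) ^ d := by
    rw [Fintype.card_fun, ZMod.card, Fintype.card_fin]; push_cast; rfl
  have hclass : ∀ r : Fin d → ZMod P.sk.a,
      (P.sparseState r ω).meanEnergy Φ R - ω.meanEnergy Φ R =
        (∑ X ∈ (thicken ({0} : Finset (Site d)) R).powerset with (0 : Site d) ∈ X,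
          ((X.card : ℂ)⁻¹) * ∑ x ∈ P.sk.touch r X, P.delta Φ ω x X).re := by
    intro r
    rw [InfVolState.meanEnergy, InfVolState.meanEnergy, ← Complex.sub_re, InfVolState.expect_meanEnergyObs,
      InfVolState.expect_meanEnergyObs, ← Finset.sum_sub_distrib]
    congr 1
    refine Finset.sum_congr rfl fun X _ => ?_
    rw [← mul_sub, P.sparseState_expect_sub_eq_sum_delta' hR hsp ω r X]
  -- Step 2: sum over the classes and the double counting
  have htotal : ∑ r : Fin d → ZMod P.sk.a,
      ∑ X ∈ (thicken ({0} : Finset (Site d)) R).powerset with (0 : Site d) ∈ X,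
        ((X.card : ℂ)⁻¹) * ∑ x ∈ P.sk.touch r X, P.delta Φ ω x X =
      ω.expect U (krausMapOp (fun k => embedOp hΛU (P.V k)) (localHamiltonian (Φ.restrict U) univ)) -
        ω.expect U (localHamiltonian (Φ.restrict U) univ) := by
    rw [Finset.sum_comm]
    have h1 : ∀ X ∈ (thicken ({0} : Finset (Site d)) R).powerset.filter (fun X => (0 : Site d) ∈ X),
        ∑ r : Fin d → ZMod P.sk.a, ((X.card : ℂ)⁻¹) * ∑ x ∈ P.sk.touch r X, P.delta Φ ω x X =
          ∑ x ∈ P.sk.allTouch X, ((X.card : ℂ)⁻¹) * P.delta0 Φ ω (shiftSet (-x) X) := by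
      intro X _
      rw [← Finset.mul_sum, P.sk.sum_sum_touch_eq_sum_allTouch X, Finset.mul_sum]
      exact Finset.sum_congr rfl fun x _ => by rw [P.delta_eq_delta0 hT hωT x X]
    rw [Finset.sum_congr rfl h1, P.sum_sum_allTouch_eq_sum_rooted (P.delta0 Φ ω) R,
      Finset.sum_congr rfl (fun Z hZ => P.sum_roots_eq hR ω (Finset.mem_filter.1 hZ).2),
      Finset.sum_filter_of_ne (fun Z hZ hne => ?_), P.sum_delta0_powerset Φ ω hΛU]
    -- regions disjoint from `Λ₀` do not contribute
    intro hdis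
    exact hne (P.delta0_eq_zero_of_disjoint Φ ω hdis)
  -- Step 3: assemble
  rw [P.meanEnergy_cellState Φ R ω, hN]
  have hsum : ∑ r : Fin d → ZMod P.sk.a, (P.sparseState r ω).meanEnergy Φ R =
      (Fintype.card (Fin d → ZMod P.sk.a) : ℝ) * ω.meanEnergy Φ R +
        (ω.expect U (krausMapOp (fun k => embedOp hΛU (P.V k)) (localHamiltonian (Φ.restrict U) univ)) -
          ω.expect U (localHamiltonian (Φ.restrict U) univ)).re := by
    have : ∀ r : Fin d → ZMod P.sk.a, (P.sparseState r ω).meanEnergy Φ R =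
        ω.meanEnergy Φ R + (∑ X ∈ (thicken ({0} : Finset (Site d)) R).powerset with (0 : Site d) ∈ X,
          ((X.card : ℂ)⁻¹) * ∑ x ∈ P.sk.touch r X, P.delta Φ ω x X).re := fun r => by
      rw [← hclass r]; ring
    rw [Finset.sum_congr rfl (fun r _ => this r), Finset.sum_add_distrib, Finset.sum_const, Finset.card_univ,
      nsmul_eq_mul, ← Complex.re_sum, htotal]
  rw [hsum, hN]
  have hpos : (P.sk.a : ℝ) ^ d ≠ 0 := pow_ne_zero _ (Nat.cast_ne_zero.2 (NeZero.ne P.sk.a))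
  field_simp
  ring

end SpinKrausPattern

/-! ### §3. The Kraus pair `(tA, √(1 − t²A⋆A))`: continuous functional calculus on matrix algebras -/

section CFCKit

variable {n : Type*} [Fintype n] [DecidableEq n]

/-- `0 ≤ 1 − √(1−u) ≤ u` on `[0,1]`. [folklore] -/
private theorem one_sub_sqrt_bounds {u : ℝ} (h0 : 0 ≤ u) (h1 : u ≤ 1) :
    0 ≤ 1 - Real.sqrt (1 - u) ∧ 1 - Real.sqrt (1 - u) ≤ u := by
  have hs0 : 0 ≤ Real.sqrt (1 - u) := Real.sqrt_nonneg _
  have hs2 : Real.sqrt (1 - u) ^ 2 = 1 - u := Real.sq_sqrt (by linarith)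
  have hs1 : Real.sqrt (1 - u) ≤ 1 := by nlinarith
  refine ⟨by linarith, ?_⟩
  nlinarith [mul_nonneg hs0 (sub_nonneg.2 hs1)]

/-- `0 ≤ 1 − √(1−u) − u/2 ≤ u²/2` on `[0,1]`. [folklore] -/
private theorem one_sub_sqrt_sub_half_bounds {u : ℝ} (h0 : 0 ≤ u) (h1 : u ≤ 1) :
    0 ≤ 1 - Real.sqrt (1 - u) - u / 2 ∧ 1 - Real.sqrt (1 - u) - u / 2 ≤ u ^ 2 / 2 := by
  have hs0 : 0 ≤ Real.sqrt (1 - u) := Real.sqrt_nonneg _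
  constructor
  · have h : Real.sqrt (1 - u) ≤ 1 - u / 2 := by
      rw [Real.sqrt_le_left (by linarith)]; nlinarith
    linarith
  · by_cases hq : 1 - u / 2 - u ^ 2 / 2 < 0
    · linarith
    · have hq' : 0 ≤ 1 - u / 2 - u ^ 2 / 2 := le_of_not_gt hq
      have hpoly : (1 - u / 2 - u ^ 2 / 2) ^ 2 ≤ 1 - u := by
        nlinarith [mul_nonneg (mul_nonneg (sq_nonneg u) (sub_nonneg.2 h1)) (by linarith : (0:ℝ) ≤ 3 + u)]
      have h : 1 - u / 2 - u ^ 2 / 2 ≤ Real.sqrt (1 - u) := Real.le_sqrt_of_sq_le hpoly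
      linarith

/-- **The second Kraus operator** `S_t(N) = √(1 − t²N)` of the pair `(tA, √(1 − t²A⋆A))`, `N = A⋆A`, on a
complex matrix algebra, defined by the (real) continuous functional calculus of the self-adjoint `N`
(Bratteli–Kishimoto–Robinson perturb by the semigroup `e^{tγ_B}`, `γ_B(A) = B⋆AB − ½(B⋆BA + AB⋆B)`;
`(tA, S_t)` is its one-step Kraus discretisation; the tree's `krausSqrt` is the same operator on the
fermionic local algebras). [cite: BratteliKishimotoRobinson1978, Thm. 1 (proof, the generator γ_B)] -/
def cpKrausSqrt (t : ℝ) (N : Matrix n n ℂ) : Matrix n n ℂ :=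
  cfc (fun x : ℝ => Real.sqrt (1 - t ^ 2 * x)) N

/-- `S_t` is self-adjoint. [cite: BratteliKishimotoRobinson1978, Thm. 1 (proof)] -/
theorem cpKrausSqrt_isSelfAdjoint (t : ℝ) (N : Matrix n n ℂ) : IsSelfAdjoint (cpKrausSqrt t N) :=
  cfc_predicate _ _

/-- `S_tᴴ = S_t`. [cite: BratteliKishimotoRobinson1978, Thm. 1 (proof)] -/
theorem cpKrausSqrt_conjTranspose (t : ℝ) (N : Matrix n n ℂ) : (cpKrausSqrt t N)ᴴ = cpKrausSqrt t N := by
  rw [← Matrix.star_eq_conjTranspose]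
  exact (cpKrausSqrt_isSelfAdjoint t N).star_eq

omit [DecidableEq n] in
/-- `A⋆A` is self-adjoint. [folklore] -/
private theorem isSelfAdjoint_conjTranspose_mul_self' (B : Matrix n n ℂ) : IsSelfAdjoint (Bᴴ * B) := by
  rw [IsSelfAdjoint, Matrix.star_eq_conjTranspose, Matrix.conjTranspose_mul,
    Matrix.conjTranspose_conjTranspose]

/-- **Kraus completeness of the pair**: `S_t² = 1 − t²N` as soon as `t²x ≤ 1` on the spectrum of `N`.
[cite: BratteliKishimotoRobinson1978, Thm. 1 (proof)] -/
theorem cpKrausSqrt_mul_self {t : ℝ} {N : Matrix n n ℂ} (hN : IsSelfAdjoint N)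
    (hsp : ∀ x ∈ spectrum ℝ N, t ^ 2 * x ≤ 1) :
    cpKrausSqrt t N * cpKrausSqrt t N = 1 - (t ^ 2) • N := by
  unfold cpKrausSqrt
  rw [← cfc_mul (fun x : ℝ => Real.sqrt (1 - t ^ 2 * x)) (fun x : ℝ => Real.sqrt (1 - t ^ 2 * x)) N]
  have h1 : cfc (fun x : ℝ => Real.sqrt (1 - t ^ 2 * x) * Real.sqrt (1 - t ^ 2 * x)) N =
      cfc (fun x : ℝ => 1 - t ^ 2 * x) N :=
    cfc_congr fun x hx => Real.mul_self_sqrt (by linarith [hsp x hx])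
  rw [h1, cfc_sub (fun _ : ℝ => (1 : ℝ)) (fun x : ℝ => t ^ 2 * x) N, cfc_const_one ℝ N,
    cfc_const_mul (t ^ 2) (fun x : ℝ => x) N, cfc_id' ℝ N]

omit [Fintype n] [DecidableEq n] in
/-- Real scalars act on a complex matrix algebra through `ℝ ⊆ ℂ`. [folklore] -/
private theorem real_smul_eq_coe_smul' (r : ℝ) (M : Matrix n n ℂ) : r • M = (r : ℂ) • M := by
  ext i j
  simp only [Matrix.smul_apply, Complex.real_smul, smul_eq_mul]

/-- `(tA)⋆(tA) + S_t⋆ S_t = 1` for `S_t = √(1 − t²A⋆A)`, `t²x ≤ 1` on `σ(A⋆A)`.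
[cite: BratteliKishimotoRobinson1978, Thm. 1 (proof)] -/
theorem cpKrausPair_complete {t : ℝ} (A : Matrix n n ℂ) (hsp : ∀ x ∈ spectrum ℝ (Aᴴ * A), t ^ 2 * x ≤ 1) :
    ((t : ℂ) • A)ᴴ * ((t : ℂ) • A) + (cpKrausSqrt t (Aᴴ * A))ᴴ * cpKrausSqrt t (Aᴴ * A) = 1 := by
  rw [cpKrausSqrt_conjTranspose, cpKrausSqrt_mul_self (isSelfAdjoint_conjTranspose_mul_self' A) hsp,
    Matrix.conjTranspose_smul, Matrix.smul_mul, Matrix.mul_smul, smul_smul, Complex.star_def,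
    Complex.conj_ofReal, real_smul_eq_coe_smul', Complex.ofReal_pow, ← pow_two, add_sub_cancel]

/-- **`S_t` is covariant under isotony**: `(S_t(N)) ⊗ 𝟙 = S_t(N ⊗ 𝟙)` (the functional calculus commutes
with the `⋆`-homomorphism `embedOpStarAlgHom`). [cite: BratteliRobinsonII1997, §6.2.1 (isotony is a *-homomorphism)] -/
theorem embedOp_cpKrausSqrt {Λ Λ' : Finset (Site d)} (hΛ : Λ ⊆ Λ') (t : ℝ) {N : Op ↥Λ q}
    (hN : IsSelfAdjoint N) : embedOp hΛ (cpKrausSqrt t N) = cpKrausSqrt t (embedOp hΛ N) := by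
  have hcont : Continuous (embedOpStarAlgHom (q := q) hΛ) :=
    LinearMap.continuous_of_finiteDimensional ((embedOpStarAlgHom (q := q) hΛ).toLinearMap)
  have hN' : IsSelfAdjoint (embedOpStarAlgHom (q := q) hΛ N) := by
    rw [embedOpStarAlgHom_apply, IsSelfAdjoint, Matrix.star_eq_conjTranspose, ← embedOp_conjTranspose,
      ← Matrix.star_eq_conjTranspose, hN.star_eq]
  exact (embedOpStarAlgHom (q := q) hΛ).map_cfc (S := ℂ) (fun x : ℝ => Real.sqrt (1 - t ^ 2 * x)) N
    (hφ := hcont) (ha := hN) (hφa := hN')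

open scoped Matrix.Norms.L2Operator

/-- The (real) spectrum of a self-adjoint element is bounded by its norm. [folklore] -/
private theorem le_norm_of_mem_spectrum' {N : Matrix n n ℂ} (hN : IsSelfAdjoint N) {x : ℝ}
    (hx : x ∈ spectrum ℝ N) : x ≤ ‖N‖ := by
  have h := norm_apply_le_norm_cfc (fun y : ℝ => y) N hx
  rw [cfc_id' ℝ N, Real.norm_eq_abs] at h
  exact (le_abs_self x).trans h

/-- The spectrum of `A⋆A` is nonnegative. [folklore] -/
private theorem spectrum_nonneg_of_conjTranspose_mul_self' (B : Matrix n n ℂ) {x : ℝ}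
    (hx : x ∈ spectrum ℝ (Bᴴ * B)) : 0 ≤ x := by
  have hP : (Bᴴ * B).PosSemidef := Matrix.posSemidef_conjTranspose_mul_self B
  rw [hP.1.spectrum_real_eq_range_eigenvalues] at hx
  obtain ⟨i, rfl⟩ := hx
  exact hP.eigenvalues_nonneg i

/-- `t²x ≤ 1` on `σ(A⋆A)` as soon as `t²‖A⋆A‖ ≤ 1`. [cite: BratteliKishimotoRobinson1978, Thm. 1 (proof)] -/
theorem spectrum_smallness_of_sq_mul_norm_le (B : Matrix n n ℂ) {t : ℝ} (ht : t ^ 2 * ‖Bᴴ * B‖ ≤ 1) :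
    ∀ x ∈ spectrum ℝ (Bᴴ * B), t ^ 2 * x ≤ 1 := fun _ hx =>
  (mul_le_mul_of_nonneg_left (le_norm_of_mem_spectrum' (isSelfAdjoint_conjTranspose_mul_self' B) hx)
    (sq_nonneg t)).trans ht

/-- **First-order size of the second Kraus operator**: `‖1 − S_t‖ ≤ t²‖A⋆A‖` (`t²‖A⋆A‖ ≤ 1`).
[cite: BratteliKishimotoRobinson1978, Thm. 1 (proof: expansion of e^{tγ_B})] -/
theorem norm_one_sub_cpKrausSqrt_le (B : Matrix n n ℂ) {t : ℝ} (ht : t ^ 2 * ‖Bᴴ * B‖ ≤ 1) :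
    ‖1 - cpKrausSqrt t (Bᴴ * B)‖ ≤ t ^ 2 * ‖Bᴴ * B‖ := by
  have hN := isSelfAdjoint_conjTranspose_mul_self' B
  have h1 : 1 - cpKrausSqrt t (Bᴴ * B) = cfc (fun x : ℝ => 1 - Real.sqrt (1 - t ^ 2 * x)) (Bᴴ * B) := by
    rw [cpKrausSqrt, cfc_sub (fun _ : ℝ => (1 : ℝ)) (fun x : ℝ => Real.sqrt (1 - t ^ 2 * x)) (Bᴴ * B),
      cfc_const_one ℝ (Bᴴ * B)]
  rw [h1]
  refine norm_cfc_le (by positivity) fun x hx => ?_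
  have hx0 := spectrum_nonneg_of_conjTranspose_mul_self' B hx
  have hx1 : t ^ 2 * x ≤ t ^ 2 * ‖Bᴴ * B‖ :=
    mul_le_mul_of_nonneg_left (le_norm_of_mem_spectrum' hN hx) (sq_nonneg t)
  obtain ⟨ha, hb⟩ := one_sub_sqrt_bounds (u := t ^ 2 * x) (by positivity) (hx1.trans ht)
  rw [Real.norm_eq_abs, abs_of_nonneg ha]
  exact hb.trans hx1

/-- **Second-order size**: `‖1 − S_t − ½t²A⋆A‖ ≤ ½(t²‖A⋆A‖)²` (`t²‖A⋆A‖ ≤ 1`).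
[cite: BratteliKishimotoRobinson1978, Thm. 1 (proof: expansion of e^{tγ_B})] -/
theorem norm_one_sub_cpKrausSqrt_sub_smul_le (B : Matrix n n ℂ) {t : ℝ} (ht : t ^ 2 * ‖Bᴴ * B‖ ≤ 1) :
    ‖1 - cpKrausSqrt t (Bᴴ * B) - ((t ^ 2 / 2 : ℝ) : ℂ) • (Bᴴ * B)‖ ≤ (t ^ 2 * ‖Bᴴ * B‖) ^ 2 / 2 := by
  have hN := isSelfAdjoint_conjTranspose_mul_self' B
  have h1 : 1 - cpKrausSqrt t (Bᴴ * B) - ((t ^ 2 / 2 : ℝ) : ℂ) • (Bᴴ * B) =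
      cfc (fun x : ℝ => 1 - Real.sqrt (1 - t ^ 2 * x) - t ^ 2 / 2 * x) (Bᴴ * B) := by
    rw [cpKrausSqrt, cfc_sub (fun x : ℝ => 1 - Real.sqrt (1 - t ^ 2 * x)) (fun x : ℝ => t ^ 2 / 2 * x) (Bᴴ * B),
      cfc_sub (fun _ : ℝ => (1 : ℝ)) (fun x : ℝ => Real.sqrt (1 - t ^ 2 * x)) (Bᴴ * B),
      cfc_const_one ℝ (Bᴴ * B), cfc_const_mul (t ^ 2 / 2) (fun x : ℝ => x) (Bᴴ * B), cfc_id' ℝ (Bᴴ * B),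
      real_smul_eq_coe_smul']
  rw [h1]
  refine norm_cfc_le (by positivity) fun x hx => ?_
  have hx0 := spectrum_nonneg_of_conjTranspose_mul_self' B hx
  have hx1 : t ^ 2 * x ≤ t ^ 2 * ‖Bᴴ * B‖ :=
    mul_le_mul_of_nonneg_left (le_norm_of_mem_spectrum' hN hx) (sq_nonneg t)
  have hu0 : 0 ≤ t ^ 2 * x := by positivity
  obtain ⟨ha, hb⟩ := one_sub_sqrt_sub_half_bounds (u := t ^ 2 * x) hu0 (hx1.trans ht)
  have hrew : 1 - Real.sqrt (1 - t ^ 2 * x) - t ^ 2 / 2 * x = 1 - Real.sqrt (1 - t ^ 2 * x) - t ^ 2 * x / 2 := by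
    ring
  rw [hrew, Real.norm_eq_abs, abs_of_nonneg ha]
  refine hb.trans ?_
  have : (t ^ 2 * x) ^ 2 ≤ (t ^ 2 * ‖Bᴴ * B‖) ^ 2 := pow_le_pow_left₀ hu0 hx1 2
  linarith

end CFCKit

/-! ### §4. From complete-positivity stability to the Bratteli–Robinson inequality -/

namespace InfVolState

open scoped Matrix.Norms.L2Operator in
/-- **The infinitesimal step.** Let `H = H⋆ ∈ 𝔄_{Λ'}`, `B ∈ 𝔄_{Λ'}`, and suppose that for all small `t > 0`
the state `ω` does not gain energy under the Kraus pair `(tB, S_t)`, `S_t = √(1 − t²B⋆B)`: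
`Re ω(H) ≤ Re ω((tB)⋆H(tB) + S_t H S_t)`. Then `Re ω(B⋆[H, B]) ≥ 0` — expand
`S_t = 1 − ½t²B⋆B + O(t⁴)`: the first-order terms give `t²·Re ω(B⋆HB − B⋆BH)`, the rest is `O(t⁴)`.
(Bratteli–Kishimoto–Robinson differentiate `t ↦ ω(e^{tγ_B}(H))` at `t = 0`.)
[cite: BratteliKishimotoRobinson1978, Thm. 1 (proof, `2 ⇒ 1`)] -/
theorem re_expect_conj_commutator_nonneg_of_cpStable (ω : InfVolState d q) {Λ' : Finset (Site d)}
    {H : Op ↥Λ' q} (hH : H.IsHermitian) (B : Op ↥Λ' q) {t₁ : ℝ} (ht₁ : 0 < t₁)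
    (hstab : ∀ t : ℝ, 0 < t → t ≤ t₁ →
      (ω.expect Λ' H).re ≤ (ω.expect Λ' (((t : ℂ) • B)ᴴ * H * ((t : ℂ) • B) +
        (cpKrausSqrt t (Bᴴ * B))ᴴ * H * cpKrausSqrt t (Bᴴ * B))).re) :
    0 ≤ (ω.expect Λ' (Bᴴ * (H * B - B * H))).re := by
  have hNsa : (Bᴴ * B)ᴴ = Bᴴ * B := by rw [Matrix.conjTranspose_mul, Matrix.conjTranspose_conjTranspose]
  -- `c = Re ω(B⋆HB) − Re ω(B⋆B H)`
  have hc : (ω.expect Λ' (Bᴴ * (H * B - B * H))).re =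
      (ω.expect Λ' (Bᴴ * H * B)).re - (ω.expect Λ' (Bᴴ * B * H)).re := by
    rw [Matrix.mul_sub, ← Matrix.mul_assoc, ← Matrix.mul_assoc, map_sub, Complex.sub_re]
  -- `Re ω(H B⋆B) = Re ω(B⋆B H)`
  have hHN : (ω.expect Λ' (H * (Bᴴ * B))).re = (ω.expect Λ' (Bᴴ * B * H)).re := by
    have : H * (Bᴴ * B) = (Bᴴ * B * H)ᴴ := by rw [Matrix.conjTranspose_mul, hH.eq, hNsa]
    rw [this, ω.expect_conjTranspose_holds, Complex.star_def, Complex.conj_re]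
  -- the two norm bounds and the smallness facts, then generalize the operators away
  have key : ∀ t : ℝ, 0 < t → t ≤ t₁ → t ^ 2 * ‖Bᴴ * B‖ ≤ 1 →
      0 ≤ t ^ 2 * (ω.expect Λ' (Bᴴ * (H * B - B * H))).re + 2 * ((t ^ 2 * ‖Bᴴ * B‖) ^ 2 * ‖H‖) := by
    intro t ht0 ht1 htn
    have hst := hstab t ht0 ht1
    have hSsa : (cpKrausSqrt t (Bᴴ * B))ᴴ = cpKrausSqrt t (Bᴴ * B) := cpKrausSqrt_conjTranspose t _
    have hDn := norm_one_sub_cpKrausSqrt_le B htn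
    have hEn := norm_one_sub_cpKrausSqrt_sub_smul_le B htn
    have h1 : ((t : ℂ) • B)ᴴ * H * ((t : ℂ) • B) = ((t ^ 2 : ℝ) : ℂ) • (Bᴴ * H * B) := by
      rw [Matrix.conjTranspose_smul, Matrix.smul_mul, Matrix.smul_mul, Matrix.mul_smul, smul_smul,
        Complex.star_def, Complex.conj_ofReal, Complex.ofReal_pow, pow_two]
    rw [h1, hSsa] at hst
    rw [hc]
    -- name the operators
    obtain ⟨S, hS⟩ : ∃ S, cpKrausSqrt t (Bᴴ * B) = S := ⟨_, rfl⟩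
    rw [hS] at hst hDn hEn
    obtain ⟨N, hN⟩ : ∃ N, Bᴴ * B = N := ⟨_, rfl⟩
    rw [hN] at hDn hEn hHN ⊢
    set D : Op ↥Λ' q := 1 - S with hDdef
    set E : Op ↥Λ' q := 1 - S - ((t ^ 2 / 2 : ℝ) : ℂ) • N with hEdef
    have hSD : S = 1 - D := by rw [hDdef, sub_sub_cancel]
    have hDE : D = E + ((t ^ 2 / 2 : ℝ) : ℂ) • N := by rw [hEdef, hDdef, sub_add_cancel]
    -- expand `S H S`
    have h2 : S * H * S = H - (D * H + H * D) + D * H * D := by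
      rw [hSD]; noncomm_ring
    have h3 : D * H + H * D = (E * H + H * E) + ((t ^ 2 / 2 : ℝ) : ℂ) • (N * H + H * N) := by
      rw [hDE, Matrix.add_mul, Matrix.mul_add, Matrix.smul_mul, Matrix.mul_smul, smul_add]; abel
    have hre : (ω.expect Λ' (((t ^ 2 : ℝ) : ℂ) • (Bᴴ * H * B) + S * H * S)).re =
        t ^ 2 * (ω.expect Λ' (Bᴴ * H * B)).re + ((ω.expect Λ' H).re
          - ((ω.expect Λ' (E * H)).re + (ω.expect Λ' (H * E)).re + t ^ 2 * (ω.expect Λ' (N * H)).re)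
          + (ω.expect Λ' (D * H * D)).re) := by
      rw [h2, h3]
      simp only [map_add, map_sub, map_smul, smul_eq_mul, Complex.add_re, Complex.sub_re,
        Complex.re_ofReal_mul, hHN]
      ring
    rw [hre] at hst
    -- bounds on the error terms
    have e1 : |(ω.expect Λ' (E * H)).re| ≤ (t ^ 2 * ‖N‖) ^ 2 / 2 * ‖H‖ :=
      (ω.abs_re_expect_le Λ' _).trans ((norm_mul_le _ _).trans (mul_le_mul_of_nonneg_right hEn (norm_nonneg _)))
    have e2 : |(ω.expect Λ' (H * E)).re| ≤ ‖H‖ * ((t ^ 2 * ‖N‖) ^ 2 / 2) :=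
      (ω.abs_re_expect_le Λ' _).trans ((norm_mul_le _ _).trans (mul_le_mul_of_nonneg_left hEn (norm_nonneg _)))
    have e3 : |(ω.expect Λ' (D * H * D)).re| ≤ (t ^ 2 * ‖N‖) * ‖H‖ * (t ^ 2 * ‖N‖) := by
      refine (ω.abs_re_expect_le Λ' _).trans ((norm_mul_le _ _).trans ?_)
      exact mul_le_mul ((norm_mul_le _ _).trans (mul_le_mul_of_nonneg_right hDn (norm_nonneg _)))
        hDn (norm_nonneg _) (by positivity)
    rw [abs_le] at e1 e2 e3
    nlinarith [e1.1, e1.2, e2.1, e2.2, e3.1, e3.2]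
  -- conclude by taking `t` small
  obtain ⟨nn, hn⟩ : ∃ nn, ‖Bᴴ * B‖ = nn := ⟨_, rfl⟩
  obtain ⟨h, hh⟩ : ∃ h, ‖H‖ = h := ⟨_, rfl⟩
  obtain ⟨c, hcc⟩ : ∃ c, (ω.expect Λ' (Bᴴ * (H * B - B * H))).re = c := ⟨_, rfl⟩
  have hn0 : 0 ≤ nn := hn ▸ norm_nonneg _
  have hh0 : 0 ≤ h := hh ▸ norm_nonneg _
  rw [hn, hh, hcc] at key
  by_contra hneg
  push Not at hneg
  -- choose `t² = ε` with `ε ≤ t₁²`, `ε nn ≤ 1`, `ε (4 nn² h + 1) ≤ -c`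
  obtain ⟨ε, hε0, hε1, hε2, hε3⟩ :
      ∃ ε : ℝ, 0 < ε ∧ ε ≤ t₁ ^ 2 ∧ ε * nn ≤ 1 ∧ ε * (4 * (nn ^ 2 * h) + 1) ≤ -c := by
    have hpos : 0 < 4 * (nn ^ 2 * h) + 1 := by positivity
    refine ⟨min (min (t₁ ^ 2) (1 / (nn + 1))) (-c / (4 * (nn ^ 2 * h) + 1)), ?_, ?_, ?_, ?_⟩
    · exact lt_min (lt_min (pow_pos ht₁ 2) (by positivity)) (div_pos (by linarith) hpos)
    · exact (min_le_left _ _).trans (min_le_left _ _)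
    · have h1 : min (min (t₁ ^ 2) (1 / (nn + 1))) (-c / (4 * (nn ^ 2 * h) + 1)) ≤ 1 / (nn + 1) :=
        (min_le_left _ _).trans (min_le_right _ _)
      calc min (min (t₁ ^ 2) (1 / (nn + 1))) (-c / (4 * (nn ^ 2 * h) + 1)) * nn ≤ 1 / (nn + 1) * nn :=
            mul_le_mul_of_nonneg_right h1 hn0
        _ ≤ 1 := by rw [div_mul_eq_mul_div, one_mul, div_le_one (by positivity)]; linarith
    · have h1 : min (min (t₁ ^ 2) (1 / (nn + 1))) (-c / (4 * (nn ^ 2 * h) + 1)) ≤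
          -c / (4 * (nn ^ 2 * h) + 1) := min_le_right _ _
      calc min (min (t₁ ^ 2) (1 / (nn + 1))) (-c / (4 * (nn ^ 2 * h) + 1)) * (4 * (nn ^ 2 * h) + 1)
          ≤ -c / (4 * (nn ^ 2 * h) + 1) * (4 * (nn ^ 2 * h) + 1) := mul_le_mul_of_nonneg_right h1 hpos.le
        _ = -c := div_mul_cancel₀ _ hpos.ne'
  have ht0 : 0 < Real.sqrt ε := Real.sqrt_pos.2 hε0
  have ht2 : Real.sqrt ε ^ 2 = ε := Real.sq_sqrt hε0.le
  have ht1 : Real.sqrt ε ≤ t₁ := by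
    rw [Real.sqrt_le_left ht₁.le]
    exact hε1
  have hk := key (Real.sqrt ε) ht0 ht1 (by rw [ht2]; exact hε2)
  rw [ht2] at hk
  nlinarith [mul_nonneg hε0.le (mul_nonneg (sq_nonneg nn) hh0), mul_nonneg hε0.le hε0.le]

end InfVolState

/-! ### §5. Complete-positivity stability of a translation-invariant minimiser, and the theorem -/

/-- **The spin Kraus pattern at `Λ`**: the Kraus family `V` placed at `Λ`, to be repeated with spacing
`a = 2·coordBound Λ + ⌊R⌋ + 1` (larger than the extent of `Λ` plus the range).
[cite: BratteliKishimotoRobinson1978, Thm. 2 (proof)] -/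
def spinKrausPatternAt (Λ : Finset (Site d)) (R : ℝ) {m : ℕ} (V : Fin m → Op ↥Λ q)
    (hV : ∑ k, (V k)ᴴ * V k = 1) : SpinKrausPattern d q where
  Λ₀ := Λ
  m := m
  V := V
  a := 2 * coordBound Λ + ⌊R⌋₊ + 1
  sum_conjTranspose_mul := hV
  sub_lt x hx y hy i := by
    have h := sub_apply_add_lt_of_mem hx hy i ⌊R⌋₊
    push_cast at h ⊢
    linarith

namespace InfVolState

/-- **Complete-positivity stability of a minimiser.** If the translation-invariant state `ω` minimises the
mean energy of the translation-invariant, finite-range interaction `Φ` of a quantum spin system, then for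
every region `Λ` and every finite Kraus family `V_k ∈ 𝔄_Λ` with `Σ_k V_k⋆V_k = 1`:
`Re ω(H_{Λ_R}) ≤ Re ω(Σ_k (V_k⊗𝟙)⋆ H_{Λ_R} (V_k⊗𝟙))` — the energy of `ω` near `Λ` is not lowered by the
completely positive unital perturbation `𝓔 = Σ_k V_k⋆(·)V_k` (else repeating `𝓔` along a sparse
sublattice and averaging would give a translation-invariant state of smaller mean energy,
`SpinKrausPattern.meanEnergy_cellState_eq`). [cite: BratteliKishimotoRobinson1978, Thm. 2 (proof, `2 ⇒ 1`); Ruelle1969GroundState Thm. 2] -/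
theorem IsMeanEnergyMinimiser.re_expect_le_re_expect_krausMapOp {Φ : LatticeInteraction d q} {R : ℝ}
    (hR : Φ.HasFiniteRange R) (hT : Φ.IsTranslationInvariant) {ω : InfVolState d q}
    (hmin : ω.IsMeanEnergyMinimiser Φ R) (Λ : Finset (Site d)) {m : ℕ} (V : Fin m → Op ↥Λ q)
    (hV : ∑ k, (V k)ᴴ * V k = 1) :
    (ω.expect (thicken Λ R) (localHamiltonian (Φ.restrict (thicken Λ R)) univ)).re ≤
      (ω.expect (thicken Λ R) (krausMapOp (fun k => embedOp (subset_thicken Λ R) (V k))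
        (localHamiltonian (Φ.restrict (thicken Λ R)) univ))).re := by
  classical
  set P := spinKrausPatternAt Λ R V hV with hP
  haveI : NeZero P.sk.a := ⟨Nat.succ_ne_zero _⟩
  have hωT := hmin.1
  have hsp : ∀ y ∈ P.Λ₀, ∀ y' ∈ P.Λ₀, ∀ i, y i - y' i + ⌊R⌋₊ < P.sk.a := fun y hy y' hy' i =>
    sub_apply_add_lt_of_mem hy hy' i ⌊R⌋₊
  -- minimality against the cell-averaged perturbed state
  have hle := hmin.2 (P.cellState ω) (P.cellState_isTranslationInvariant ω hωT)
  rw [P.meanEnergy_cellState_eq hR hT hsp ω hωT] at hle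
  have hapos : 0 < ((P.sk.a : ℝ) ^ d)⁻¹ := inv_pos.2 (pow_pos (Nat.cast_pos.2 (Nat.succ_pos _)) d)
  have hΔ := (mul_nonneg_iff_of_pos_left hapos).1 (by linarith)
  -- the energy change in `U = (Λ)_{R,R}` equals the one in `Λ_R`
  have hU : P.Λ₀ ⊆ thicken (thicken P.Λ₀ R) R := (subset_thicken _ R).trans (subset_thicken _ R)
  have h1 := P.sum_delta0_powerset Φ ω hU
  have h2 : ∑ Z ∈ (thicken Λ R).powerset, P.delta0 Φ ω Z =
      ω.expect (thicken Λ R) (krausMapOp (fun k => embedOp (subset_thicken Λ R) (V k))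
          (localHamiltonian (Φ.restrict (thicken Λ R)) univ)) -
        ω.expect (thicken Λ R) (localHamiltonian (Φ.restrict (thicken Λ R)) univ) :=
    P.sum_delta0_powerset Φ ω (subset_thicken Λ R)
  have h12 : ∑ Z ∈ (thicken Λ R).powerset, P.delta0 Φ ω Z =
      ∑ Z ∈ (thicken (thicken Λ R) R).powerset, P.delta0 Φ ω Z := by
    refine Finset.sum_subset (Finset.powerset_mono.2 (subset_thicken _ R)) fun Z hZU hZΛ => ?_
    by_cases hdis : Disjoint Z Λ
    · exact P.delta0_eq_zero_of_disjoint Φ ω hdis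
    · obtain ⟨y, hyZ, hyΛ⟩ := Finset.not_disjoint_iff.1 hdis
      obtain ⟨z, hzZ, hz⟩ := Finset.not_subset.1 fun h => hZΛ (Finset.mem_powerset.2 h)
      refine P.delta0_eq_zero_of_apply_eq_zero ω (by_contra fun hne => hz ?_)
      obtain ⟨w, hw, rfl⟩ := Finset.mem_image.1 (hR.subset_image_box hne hyZ hzZ)
      exact mem_thicken_iff.2 ⟨y, hyΛ, w, hw, rfl⟩
  have hfinal : 0 ≤ (ω.expect (thicken Λ R) (krausMapOp (fun k => embedOp (subset_thicken Λ R) (V k))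
          (localHamiltonian (Φ.restrict (thicken Λ R)) univ)) -
        ω.expect (thicken Λ R) (localHamiltonian (Φ.restrict (thicken Λ R)) univ)).re := by
    rw [← h2, h12]
    exact h1.symm ▸ hΔ
  rw [Complex.sub_re] at hfinal
  linarith

open scoped Matrix.Norms.L2Operator in
/-- **Translation-invariant minimisers of the mean energy are ground states** (Bratteli–Kishimoto–Robinson
1978, Thm. 2, `(2) ⇒ (1)`; Ruelle 1969, Thm. 2 and Thm. 4), for quantum SPIN systems: let `Φ` be a
Hermitian, translation-invariant interaction of finite range `R` on `ℤ^d` (any `d`, any local dimension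
`q`), and `ω` a translation-invariant state with `e_Φ(ω) ≤ e_Φ(ω')` for every translation-invariant `ω'`
(`IsMeanEnergyMinimiser`). Then `ω` is a ground state: `-i ω(A⋆δ(A)) ≥ 0` for all local `A`
(`IsGroundState ω Φ R`). The printed `2 ⇒ 1` is Ruelle's tangent-functional argument; the proof here is the
direct finite-range perturbation argument described in the module docstring.
[cite: BratteliKishimotoRobinson1978, Thm. 2; Ruelle1969GroundState Thm. 2] -/
theorem IsMeanEnergyMinimiser.isGroundState {Φ : LatticeInteraction d q} {R : ℝ}
    (hR : Φ.HasFiniteRange R) (hH : Φ.IsHermitian) (hT : Φ.IsTranslationInvariant)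
    {ω : InfVolState d q} (hmin : ω.IsMeanEnergyMinimiser Φ R) : ω.IsGroundState Φ R := by
  intro Λ A
  have hΛ : Λ ⊆ thicken Λ R := subset_thicken Λ R
  set Λ' := thicken Λ R with hΛ'
  set H := localHamiltonian (Φ.restrict Λ') univ with hHdef
  have hHh : H.IsHermitian := localHamiltonian_isHermitian (hH.isLocal_restrict Λ') Finset.univ
  -- Step 1: the Bratteli–Robinson inequality (real part) for every local observable
  have hstabRe : ∀ A₀ : Op ↥Λ q,
      0 ≤ (ω.expect Λ' ((embedOp hΛ A₀)ᴴ * (H * embedOp hΛ A₀ - embedOp hΛ A₀ * H))).re := by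
    intro A₀
    have hN₀ : IsSelfAdjoint (A₀ᴴ * A₀) := by
      rw [IsSelfAdjoint, Matrix.star_eq_conjTranspose, Matrix.conjTranspose_mul,
        Matrix.conjTranspose_conjTranspose]
    have ht₁ : 0 < Real.sqrt (1 / (‖A₀ᴴ * A₀‖ + 1)) := Real.sqrt_pos.2 (by positivity)
    refine ω.re_expect_conj_commutator_nonneg_of_cpStable hHh (embedOp hΛ A₀) ht₁ fun t ht0 ht1 => ?_
    -- `t² x ≤ 1` on `σ(A₀⋆A₀)`
    have hsp : ∀ x ∈ spectrum ℝ (A₀ᴴ * A₀), t ^ 2 * x ≤ 1 := by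
      refine spectrum_smallness_of_sq_mul_norm_le A₀ ?_
      have ht2 : t ^ 2 ≤ 1 / (‖A₀ᴴ * A₀‖ + 1) := by
        have := pow_le_pow_left₀ ht0.le ht1 2
        rwa [Real.sq_sqrt (by positivity)] at this
      calc t ^ 2 * ‖A₀ᴴ * A₀‖ ≤ 1 / (‖A₀ᴴ * A₀‖ + 1) * ‖A₀ᴴ * A₀‖ :=
            mul_le_mul_of_nonneg_right ht2 (norm_nonneg _)
        _ ≤ 1 := by
          rw [div_mul_eq_mul_div, one_mul, div_le_one (by positivity)]
          linarith
    -- the Kraus pair `(tA₀, S_t)` placed at `Λ`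
    have hV : ∑ k : Fin 2, (![(t : ℂ) • A₀, cpKrausSqrt t (A₀ᴴ * A₀)] k)ᴴ *
        ![(t : ℂ) • A₀, cpKrausSqrt t (A₀ᴴ * A₀)] k = 1 := by
      rw [Fin.sum_univ_two]
      exact cpKrausPair_complete A₀ hsp
    have hcp := hmin.re_expect_le_re_expect_krausMapOp hR hT Λ _ hV
    rw [krausMapOp_apply, Fin.sum_univ_two] at hcp
    simp only [Matrix.cons_val_zero, Matrix.cons_val_one, embedOp_smul,
      embedOp_cpKrausSqrt hΛ t hN₀, embedOp_mul, embedOp_conjTranspose] at hcp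
    exact hcp
  -- Step 2: stationarity, and the conclusion
  set B := embedOp hΛ A with hB
  have hstat : ω.expect Λ' (H * (Bᴴ * B)) = ω.expect Λ' (Bᴴ * B * H) := by
    have h := ω.expect_commutator_eq_zero_of_localStability hΛ hstabRe (Aᴴ * A)
    rw [embedOp_mul, embedOp_conjTranspose, map_sub] at h
    exact sub_eq_zero.1 h
  have hder : derivation Φ R Λ A = Complex.I • (H * B - B * H) := rfl
  rw [hder, Matrix.mul_smul, map_smul, smul_eq_mul, ← mul_assoc,
    show -Complex.I * Complex.I = 1 by rw [neg_mul, Complex.I_mul_I, neg_neg], one_mul]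
  have hre := hstabRe A
  have him : (ω.expect Λ' (Bᴴ * (H * B - B * H))).im = 0 := by
    rw [Matrix.mul_sub, map_sub, Complex.sub_im]
    have h1 : (ω.expect Λ' (Bᴴ * (H * B))).im = 0 := by
      have hsa : (Bᴴ * (H * B))ᴴ = Bᴴ * (H * B) := by
        rw [Matrix.conjTranspose_mul, Matrix.conjTranspose_mul, hHh.eq, Matrix.conjTranspose_conjTranspose,
          Matrix.mul_assoc]
      have h := ω.expect_conjTranspose_holds Λ' (Bᴴ * (H * B))
      rw [hsa, Complex.star_def] at h
      exact Complex.conj_eq_iff_im.1 h.symm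
    have h2 : (ω.expect Λ' (Bᴴ * (B * H))).im = 0 := by
      have hsa : (Bᴴ * (B * H))ᴴ = H * (Bᴴ * B) := by
        rw [Matrix.conjTranspose_mul, Matrix.conjTranspose_mul, hHh.eq, Matrix.conjTranspose_conjTranspose,
          Matrix.mul_assoc]
      have h := ω.expect_conjTranspose_holds Λ' (Bᴴ * (B * H))
      rw [hsa, hstat, Matrix.mul_assoc, Complex.star_def] at h
      exact Complex.conj_eq_iff_im.1 h.symm
    rw [h1, h2, sub_zero]
  exact Complex.nonneg_iff.2 ⟨hre, him.symm⟩

/-- **Bratteli–Kishimoto–Robinson 1978, Theorem 2, both directions, for quantum spin systems.** For a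
Hermitian, translation-invariant interaction `Φ` of finite range `R` on `ℤ^d` (any `d`, `q`) and an
infinite-volume state `ω`, the following are equivalent: (2) `ω` minimises the mean energy `e_Φ` among the
translation-invariant states; (1) `ω` is translation invariant and a ground state of `Φ`
(`-i ω(A⋆δ(A)) ≥ 0` for all local `A`). `2 ⇒ 1` is `IsMeanEnergyMinimiser.isGroundState` (Ruelle 1969),
`1 ⇒ 2` is `IsGroundState.isMeanEnergyMinimiser` (`SpinGroundStatesMinimiseMeanEnergy.lean`).
[cite: BratteliKishimotoRobinson1978, Thm. 2 (p. 47)] [cite: Ruelle1969GroundState, Thm. 2] -/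
theorem isMeanEnergyMinimiser_iff_isGroundState {Φ : LatticeInteraction d q} {R : ℝ}
    (hR : Φ.HasFiniteRange R) (hH : Φ.IsHermitian) (hT : Φ.IsTranslationInvariant) {ω : InfVolState d q} :
    ω.IsMeanEnergyMinimiser Φ R ↔ ω.IsTranslationInvariant ∧ ω.IsGroundState Φ R :=
  ⟨fun h => ⟨h.1, h.isGroundState hR hH hT⟩, fun h => h.2.isMeanEnergyMinimiser hR hT h.1⟩

end InfVolState

/-! ### §6. Discharge of the named fact -/

/-- **Discharge of the named fact `BratteliKishimotoRobinson1978_theorem2`** (Bratteli–Kishimoto–Robinson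
1978, Thm. 2, p. 47: for a translation-invariant, Hermitian, finite-range interaction of a quantum spin
system on `ℤ^d` and a translation-invariant state `ω`, `ω` is a ground state iff `ω` minimises the mean
energy among the translation-invariant states): `1 ⇒ 2` is
`InfVolState.IsGroundState.meanEnergy_le` (`SpinGroundStatesMinimiseMeanEnergy.lean`), `2 ⇒ 1` is
`InfVolState.IsMeanEnergyMinimiser.isGroundState` (this file); all `d` and `q`.
[cite: BratteliKishimotoRobinson1978, Thm. 2 (p. 47)] [cite: BratteliRobinsonII1997, Thm. 6.2.58] -/
theorem BratteliKishimotoRobinson1978_theorem2_holds : BratteliKishimotoRobinson1978_theorem2 := by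
  intro d q Φ R hR hH hT ω hω
  exact ⟨fun hgs ω' hω' => hgs.meanEnergy_le hT hR hω hω',
    fun h => InfVolState.IsMeanEnergyMinimiser.isGroundState hR hH hT ⟨hω, h⟩⟩

/-! ### §7. The convexity consequences, unconditionally -/

namespace InfVolState

variable {Φ : LatticeInteraction d q} {R : ℝ}

/-- **The translation-invariant ground states form a face of the invariant states** (the hypothesis-form
`BratteliKishimotoRobinson1978_theorem2.isGroundState_of_mix` fed with the discharge): if a non-trivial
mixture `t ω₁ + (1-t) ω₂` (`0 < t < 1`) of translation-invariant states is a ground state of the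
Hermitian, translation-invariant, finite-range interaction `Φ`, then so are `ω₁` and `ω₂`.
[cite: BratteliKishimotoRobinson1978, Thm. 2 (p. 47)] [cite: BratteliRobinsonI1987, §4.3.1] -/
theorem IsGroundState.of_mix_spin (hR : Φ.HasFiniteRange R) (hH : Φ.IsHermitian)
    (hT : Φ.IsTranslationInvariant) {t : ℝ} {ht₀ : 0 ≤ t} {ht₁ : t ≤ 1} (ht : 0 < t) (ht' : t < 1)
    {ω₁ ω₂ : InfVolState d q} (h₁ : ω₁.IsTranslationInvariant) (h₂ : ω₂.IsTranslationInvariant)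
    (hgs : (InfVolState.mix t ht₀ ht₁ ω₁ ω₂).IsGroundState Φ R) :
    ω₁.IsGroundState Φ R ∧ ω₂.IsGroundState Φ R :=
  BratteliKishimotoRobinson1978_theorem2_holds.isGroundState_of_mix hR hH hT ht ht' h₁ h₂ hgs

/-- **The extreme points of the set of translation-invariant ground states are ergodic states**: a
translation-invariant ground state of the Hermitian, translation-invariant, finite-range interaction `Φ`
which is extremal among the translation-invariant ground states is extremal among ALL
translation-invariant states (`InfVolState.IsErgodic`) — the invariant ground states are the mean-energy
minimisers (`isMeanEnergyMinimiser_iff_isGroundState`), which form a face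
(`IsMeanEnergyMinimiser.isErgodic_of_extremal`). [cite: BratteliKishimotoRobinson1978, Thm. 2 (p. 47)]
[cite: BratteliRobinsonI1987, §4.3.1 (faces of E^G and ergodic states)] -/
theorem IsGroundState.isErgodic_of_extremal_spin (hR : Φ.HasFiniteRange R) (hH : Φ.IsHermitian)
    (hT : Φ.IsTranslationInvariant) {ω : InfVolState d q} (hω : ω.IsTranslationInvariant)
    (hgs : ω.IsGroundState Φ R)
    (hext : ∀ (t : ℝ) (ht₀ : 0 ≤ t) (ht₁ : t ≤ 1) (ω₁ ω₂ : InfVolState d q), 0 < t → t < 1 →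
      ω₁.IsTranslationInvariant → ω₂.IsTranslationInvariant → ω₁.IsGroundState Φ R →
        ω₂.IsGroundState Φ R → mix t ht₀ ht₁ ω₁ ω₂ = ω → ω₁ = ω ∧ ω₂ = ω) :
    ω.IsErgodic :=
  (hgs.isMeanEnergyMinimiser hR hT hω).isErgodic_of_extremal fun t ht₀ ht₁ ω₁ ω₂ ht ht' hm₁ hm₂ hmix =>
    hext t ht₀ ht₁ ω₁ ω₂ ht ht' hm₁.1 hm₂.1 (hm₁.isGroundState hR hH hT) (hm₂.isGroundState hR hH hT) hmix

end InfVolState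

end Literature.MathematicalPhysics.QuantumLattice

end
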